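import Summits.HubbardSuperconductivity.HubbardLadder.PairCorrSectorCert
import Literature.MathematicalPhysics.QuantumLattice.HubbardNNNHoppingFluxStiffnessSecondOrder
import HarnessLib

/-!
# Glue: three sector-mode observable certificates ⇒ the second-order stiffness ceiling
# `ρ_s L² ≤ K_hi − M0_lo²/M1_hi` (cell hubbard-obs, seat p2; TARGET §5 rung 0c, R-0c-torus)

HONEST FRAMING: one-sided certified CEILINGS on the helicity modulus; not a superconductivity
verdict; no floor is obtainable from positivity + an energy window. Theorem-only glue with ONE
definition (the first-moment operator `D₁`); zero compute; the certificate VALUES are hypotheses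
(claim nodes are typed by obs-lit / eng once the certificates exist and PASS the referee).

For the `t–t'` Hubbard torus `H = hubbardTorusTT' L 1 t' U` in the sector `(N_L, S^z = 0)`,
`N_L = 2⌊(1−δ)L²/2⌋`, with energy hypothesis `minEnergyOn H (szSector N_L 0) ≤ u` (a certified upper
bound `u`, the `energy_upper` row of the three certificates), three `TorusSectorObsCertTT'`
certificates (Summits/HubbardSuperconductivity/HubbardLadder/PairCorrSectorCert.lean, the #197 type)
with objectives
* `X_K = −½ 𝒦` (`𝒦 = kinOpTT' L t'`), value `q_K`  ⇒ `K(ψ) = ½Re⟨ψ,𝒦ψ⟩ ≤ −q_K`;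
* `X_0 = 𝒥·𝒥` (`𝒥 = curOpTT' L t'`), value `q_0 ≥ 0` ⇒ `‖𝒥ψ‖² ≥ q_0`;
* `X_1 = −D₁`, `D₁ = ½(𝒥(H𝒥 − 𝒥H) − (H𝒥 − 𝒥H)𝒥) = ½[𝒥,[H,𝒥]]` (`stiffnessFirstMomentOp`), value `q_1`
  with `−q_1 > 0` ⇒ `M₁(ψ) = Re⟨𝒥ψ,(H−E₀)𝒥ψ⟩ ≤ −q_1`;
give, for EVERY flux stiffness `ρ` of the sector (`ρθ² ≤ E^{tt'}_L(θ) − E^{tt'}_L(0)` on `|θ| ≤ θ₀`,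
`θ₀ > 0`) and every unit sector ground state `ψ`:  **`ρ L² ≤ −q_K − q_0² / (−q_1)`**
(`stiffness_mul_sq_le_of_three_sectorObsCerts`; Literature T3
`stiffnessTT'_mul_sq_le_of_certified_moments` + the kernel edges `TorusSectorObsCertTT'.re_expect_ge/le`
+ the dictionary `curOpTT'_firstMoment_eq_re_doubleCommutator`). The operator words shipped to the
engines (HOME/hubbard-obs-p2/ops, kind `stiffness:OK/OM0/OM1`) are `X_K`, `X_0`, `X_1` at `L = 4`.
References: Scalapino–White–Zhang 1993 §II; Lipparini 2008 eqs. (8.30), (10.64); Wang et al. 2024 §3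
(observable certificates).
-/

noncomputable section

namespace Summit.Ventures.CertifiedManyBodySolver.Observables

open Matrix Literature.MathematicalPhysics.QuantumLattice Literature.Probability.LatticeModels
  Summit.HubbardSuperconductivity.HubbardLadder
open scoped ComplexOrder ComplexConjugate

variable {L : ℕ} [NeZero L]

section Defs

variable (L)

/-- The **first-moment operator of the `e₁`-current**, `D₁ = ½(𝒥(H𝒥 − 𝒥H) − (H𝒥 − 𝒥H)𝒥) = ½[𝒥,[H,𝒥]]`
for `𝒥 = curOpTT' L t'`, `H = hubbardTorusTT' L 1 t' U`: in every eigenvector `Hψ = Eψ`,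
`Re⟨ψ, D₁ ψ⟩ = Re⟨𝒥ψ,(H − E)𝒥ψ⟩ = M₁(ψ)` (`curOpTT'_firstMoment_eq_re_doubleCommutator`). The SDP
objective of the `M1_hi` certificate is `−D₁` (shipped words `stiffness:OM1`). HONEST FRAMING:
one-sided ceilings; not a superconductivity verdict. [cite: Lipparini2008, eq. (8.30)] -/
def stiffnessFirstMomentOp (t' U : ℝ) :
    Matrix (Finset (Orb (FermionTorus 2 L))) (Finset (Orb (FermionTorus 2 L))) ℂ :=
  ((1 / 2 : ℝ) : ℂ) •
    (curOpTT' L t' * (hubbardTorusTT' L 1 t' U * curOpTT' L t' - curOpTT' L t' * hubbardTorusTT' L 1 t' U) -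
      (hubbardTorusTT' L 1 t' U * curOpTT' L t' - curOpTT' L t' * hubbardTorusTT' L 1 t' U) *
        curOpTT' L t')

end Defs

/-- The first-moment dictionary in the glue's normalisation: for a sector ground state `ψ` of
`H = hubbardTorusTT' L 1 t' U`, `Re⟨ψ, D₁ ψ⟩ = Re⟨𝒥ψ, H 𝒥ψ⟩ − E₀ ‖𝒥ψ‖²` with `E₀` the sector energy.
[cite: Lipparini2008, eq. (8.30)] -/
theorem re_expect_stiffnessFirstMomentOp (t' U : ℝ) {N : ℕ} {M : ℝ}
    {ψ : Fock (Orb (FermionTorus 2 L))} (hgs : IsGroundStateInSector (hubbardTorusTT' L 1 t' U) N M ψ) :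
    (star ψ ⬝ᵥ (stiffnessFirstMomentOp L t' U *ᵥ ψ)).re =
      (star (curOpTT' L t' *ᵥ ψ) ⬝ᵥ (hubbardTorusTT' L 1 t' U *ᵥ (curOpTT' L t' *ᵥ ψ))).re -
        (hubbardTorusTT' L 1 t' U).minEnergyOn (szSector N M) *
          (star (curOpTT' L t' *ᵥ ψ) ⬝ᵥ (curOpTT' L t' *ᵥ ψ)).re := by
  rw [curOpTT'_firstMoment_eq_re_doubleCommutator t' U hgs, stiffnessFirstMomentOp, smul_mulVec,
    dotProduct_smul, smul_eq_mul, Complex.re_ofReal_mul]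
  ring

/-- **Three sector-mode certificates ⇒ the second-order stiffness ceiling** (`L ≥ 3`). Energy node
`minEnergyOn H (szSector N_L 0) ≤ u`; certificates for `X_K = −½𝒦` (value `q_K`), `X_0 = 𝒥𝒥`
(value `q_0 ≥ 0`), `X_1 = −D₁` (value `q_1`, `−q_1 > 0`); then every flux stiffness `ρ` of the
`(N_L, 0)` sector at any scale `θ₀ > 0` and every unit sector ground state `ψ` satisfy
`ρ L² ≤ −q_K − q_0² / (−q_1)`. HONEST FRAMING: one-sided ceiling on the helicity modulus (flux
curvature); `−q_K` alone is the f-sum ceiling; not a superconductivity verdict.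
[cite: ScalapinoWhiteZhang1993, §II] -/
theorem stiffness_mul_sq_le_of_three_sectorObsCerts (hL : 3 ≤ L) (t' U δ : ℝ) {u qK q0 q1 : ℝ}
    (hE : (hubbardTorusTT' L 1 t' U).minEnergyOn (szSector (2 * ⌊(1 - δ) * (L : ℝ) ^ 2 / 2⌋₊) 0) ≤ u)
    (CK : TorusSectorObsCertTT' L 1 t' U (2 * ⌊(1 - δ) * (L : ℝ) ^ 2 / 2⌋₊) 0 u
      (-(((1 / 2 : ℝ) : ℂ) • kinOpTT' L t')) qK)
    (C0 : TorusSectorObsCertTT' L 1 t' U (2 * ⌊(1 - δ) * (L : ℝ) ^ 2 / 2⌋₊) 0 u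
      (curOpTT' L t' * curOpTT' L t') q0) (hq0 : 0 ≤ q0)
    (C1 : TorusSectorObsCertTT' L 1 t' U (2 * ⌊(1 - δ) * (L : ℝ) ^ 2 / 2⌋₊) 0 u
      (-stiffnessFirstMomentOp L t' U) q1) (hq1 : 0 < -q1)
    {ρs θ₀ : ℝ} (hθ₀ : 0 < θ₀)
    (hstiff : ∀ θ : ℝ, |θ| ≤ θ₀ →
      ρs * θ ^ 2 ≤ fluxEnergyTT' L t' U δ θ - fluxEnergyTT' L t' U δ 0)
    {ψ : Fock (Orb (FermionTorus 2 L))}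
    (hgs : IsGroundStateInSector (hubbardTorusTT' L 1 t' U) (2 * ⌊(1 - δ) * (L : ℝ) ^ 2 / 2⌋₊) 0 ψ)
    (h1 : star ψ ⬝ᵥ ψ = 1) :
    ρs * (L : ℝ) ^ 2 ≤ -qK - q0 ^ 2 / (-q1) := by
  -- the three kernel edges
  have hK := CK.re_expect_le hE ψ h1 hgs
  have h0 := C0.re_expect_ge hE ψ h1 hgs
  have hM1 := C1.re_expect_le hE ψ h1 hgs
  -- rewrite them in the Literature normalisation
  rw [smul_mulVec, dotProduct_smul, smul_eq_mul, Complex.re_ofReal_mul] at hK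
  rw [← mulVec_mulVec, star_dotProduct_curOpTT'_curOpTT'_mulVec] at h0
  rw [re_expect_stiffnessFirstMomentOp t' U hgs] at hM1
  have hE0 : (hubbardTorusTT' L 1 t' U).minEnergyOn (szSector (2 * ⌊(1 - δ) * (L : ℝ) ^ 2 / 2⌋₊) 0) =
      fluxEnergyTT' L t' U δ 0 := by
    rw [fluxEnergyTT'_eq, hubbardTorusTT'Flux_zero]
  rw [hE0] at hM1
  exact stiffnessTT'_mul_sq_le_of_certified_moments hL t' U δ hθ₀ hstiff hgs h1
    (Khi := -qK) (by linarith) h0 hq0 hM1 hq1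

end Summit.Ventures.CertifiedManyBodySolver.Observables
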